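import Mathlib
import Summits.Ventures.PercRepro2.TypedTwoEdgeOStates
import Summits.Ventures.PercRepro2.TypedSpectator

/-!
# The two-edge `o` at `a₃`, II: a mark `o` of degree two with one edge to `a₃` reduces, at a
class-`1` attachment, to the instance with `o` contracted into its other neighbour (blind cell
PercRepro2, mine-2 g53, 2026-08-29; `conjectures/MINE-2.md` M2-111)

With `o` carrying exactly the two edges `g₁ = {o, v}` and `g₂ = {o, a₃}` (`TypedTwoEdgeOStates.lean`:
a copy contributes an `o`-term only if `g₁` is open and `g₂` closed in it), the split at `g₁` of
class `1` leaves three placements; in each the `o`-copy carries its `o`-term `KO_c` and the other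
two copies are inert, so the kernel is `KO_c` evaluated on the instance with `g₁` open and `g₂`
closed, killed when the `o`-copy has `g₂` open (a bridge).  The split at `g₂` then counts the
placements of `g₂` avoiding the `o`-copy: `C(2, τ g₂)` of them, each the same count
(**`typedCount_two_edge_o_slot`**, for any kernel term with the `o`-factor in a fixed slot; the
second and third slots by the copy swaps).  Summing the three slots gives the rule

  **`typedCount_two_edge_o_one`**: `N = C(2, τ g₂) · N(g₁ := 3, g₂ := 0)`

— the count with `o` contracted into `v` and the `o–a₃` edge removed (the leaf rule for `o` is
the case `τ g₂ = 0`; night-3 g16's `typedCount_o_a3_edge` of `TypedOA3Edge.lean` — both edges of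
type `1`, `N = 2 · N(g₂ pinned closed)`, NIGHT3-CERT.md §25.6 — is the case `τ g₂ = 1`; the
entries `τ g₂ = 2`, `N = N(g₁ := 3, g₂ := 0)`, and `τ g₂ = 3`, `N = 0`, are new), and the
reduction **`typedCount_nonneg_of_two_edge_o_one`** of row 2′TRI.
The census-mined table at class `2` (M2-111: `N(2, 0) = 2 M₀`, `N(2, 1) = 2 M₀ + M₁`,
`N(2, 2) = M₁`, `N(2, 3) = 0`, `M_j := N(g₁ := 3, g₂ := j)`) is recorded there, not proved here.
The class-`1` row explains the `o`-bridge family of the (PM-ROOT) equality locus (M2-108 add. 3,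
M2-109).  Own work; standard axioms.
-/

namespace Summit.Ventures.PercRepro2

namespace CovForm

namespace TypedRed

open OneTyped

/-! ## The class-`1` slot reduction and the theorem -/

section Theorem

open Classical

variable {V : Type*} {E : Type*} [Fintype E] [DecidableEq E] {R : Type*} [Field R]
variable (ends : E → Sym2 V) (o a₁ a₂ a₃ b : V)

omit [Fintype E] in
/-- The non-`o` data of a copy with `g₁` closed is that of the copy with `g₁` open and `g₂`
closed. -/
lemma killO_st_closed_eq {g₁ g₂ : E} {v : V} (hg₁ : ends g₁ = s(o, v))
    (hg₂ : ends g₂ = s(o, a₃)) (hdeg : ∀ e, o ∈ ends e → e = g₁ ∨ e = g₂)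
    (hov : o ≠ v) (ho1 : o ≠ a₁) (ho2 : o ≠ a₂) (ho3 : o ≠ a₃) (hob : o ≠ b) (hg12 : g₁ ≠ g₂)
    (y : Config E) :
    killO (st ends o a₁ a₂ a₃ b (Function.update y g₁ false)) =
      killO (st ends o a₁ a₂ a₃ b (Function.update (Function.update y g₁ true) g₂ false)) := by
  rw [killO_st_update_g₂ ends o a₁ a₂ a₃ b hg₁ hg₂ hdeg ho1 ho2 ho3 hob _
      (Function.update_self g₁ false y),
    Function.update_comm hg12 false false y,
    st_update_g₁_of_closed ends o a₁ a₂ a₃ b hg₁ hg₂ hdeg hov ho1 ho2 ho3 hob _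
      (Function.update_self g₂ false y),
    killO_killO, Function.update_comm hg12.symm false true y]

/-- **The class-`1` slot reduction**: for a kernel term `G` carrying the `o`-factor in its FIRST
slot (it vanishes when that slot is coincident and ignores the `o`-data of the other slots), the
typed count of `G` with the `o`-copy first, `g₁` open there and closed in the other two copies, is
`C(2, τ g₂)` times the count of `G` on the instance with `g₁` pinned open and `g₂` pinned closed
(`o` contracted into `v`, the `o–a₃` edge removed). -/
theorem typedCount_two_edge_o_slot (G : St → St → St → ℤ)
    (hG0 : ∀ x y w : St, x.Lo = x.L3 → x.Ho = x.H3 → G x y w = 0)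
    (hGy : ∀ x y w : St, G x (killO y) w = G x y w)
    (hGw : ∀ x y w : St, G x y (killO w) = G x y w)
    {g₁ g₂ : E} {v : V} (hg₁ : ends g₁ = s(o, v)) (hg₂ : ends g₂ = s(o, a₃))
    (hdeg : ∀ e, o ∈ ends e → e = g₁ ∨ e = g₂) (hov : o ≠ v) (ho1 : o ≠ a₁) (ho2 : o ≠ a₂)
    (ho3 : o ≠ a₃) (hob : o ≠ b) (hg12 : g₁ ≠ g₂)
    (F : Finset E) (hg₁F : g₁ ∉ F) (hg₂F : g₂ ∈ F) (z : Config E) (τ : E → ℕ) :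
    typedCount F (Function.update z g₁ false) τ
        (fun x y w => ((G (st ends o a₁ a₂ a₃ b (Function.update x g₁ true))
          (st ends o a₁ a₂ a₃ b (Function.update y g₁ false))
          (st ends o a₁ a₂ a₃ b (Function.update w g₁ false)) : ℤ) : R)) =
      (Nat.choose 2 (τ g₂) : R) *
        typedCount (F.erase g₂) (Function.update (Function.update z g₁ true) g₂ false) τ
          (fun x y w => ((G (st ends o a₁ a₂ a₃ b x) (st ends o a₁ a₂ a₃ b y)
            (st ends o a₁ a₂ a₃ b w) : ℤ) : R)) := by
  set S := st ends o a₁ a₂ a₃ b with hS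
  have hcl := killO_st_closed_eq ends o a₁ a₂ a₃ b hg₁ hg₂ hdeg hov ho1 ho2 ho3 hob hg12
  -- Step 1: the pointwise reduction of the kernel
  have hred : ∀ x y w : Config E,
      ((G (S (Function.update x g₁ true)) (S (Function.update y g₁ false))
        (S (Function.update w g₁ false)) : ℤ) : R) =
      if x g₂ = false then
        ((G (S (Function.update (Function.update x g₁ true) g₂ false))
          (S (Function.update (Function.update y g₁ true) g₂ false))
          (S (Function.update (Function.update w g₁ true) g₂ false)) : ℤ) : R)
      else 0 := by
    intro x y w
    rw [← hGy, ← hGw, hcl y, hcl w, hGy, hGw]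
    by_cases hx2 : x g₂ = false
    · rw [if_pos hx2]
      have : Function.update (Function.update x g₁ true) g₂ false =
          Function.update x g₁ true := by
        refine Function.update_eq_self_iff.2 ?_
        rw [Function.update_of_ne hg12.symm]; exact hx2.symm
      rw [this]
    · rw [if_neg hx2]
      have hx2' : Function.update x g₁ true g₂ = true := by
        rw [Function.update_of_ne hg12.symm]; simpa using hx2
      obtain ⟨h1, h2⟩ := st_coinc_of_open ends o a₁ a₂ a₃ b hg₂ _ hx2'
      rw [hG0 _ _ _ h1 h2]
      push_cast
      rfl
  rw [typedCount_congr_K _ _ _ hred, typedCount_split F g₂ hg₂F]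
  -- Step 2: every placement of `g₂` with the first copy closed contributes the same count
  set z₀ := Function.update (Function.update z g₁ false) g₂ false with hz₀
  set C₀ : R := typedCount (F.erase g₂) z₀ τ
    (fun x y w => ((G (S (Function.update (Function.update x g₁ true) g₂ false))
      (S (Function.update (Function.update y g₁ true) g₂ false))
      (S (Function.update (Function.update w g₁ true) g₂ false)) : ℤ) : R)) with hC₀
  have hterm : ∀ a b c : Bool, typedCount (F.erase g₂) z₀ τ
      (fun x y w => (fun x y w => if x g₂ = false then
        ((G (S (Function.update (Function.update x g₁ true) g₂ false))
          (S (Function.update (Function.update y g₁ true) g₂ false))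
          (S (Function.update (Function.update w g₁ true) g₂ false)) : ℤ) : R) else 0)
        (Function.update x g₂ a) (Function.update y g₂ b) (Function.update w g₂ c)) =
      if a = false then C₀ else 0 := by
    intro a b c
    rw [hC₀, ← typedCount_ite]
    refine typedCount_congr_K _ _ _ fun x y w => ?_
    show (if Function.update x g₂ a g₂ = false then _ else 0) = _
    rw [Function.update_self, Function.update_comm hg12.symm a true x,
      Function.update_comm hg12.symm b true y, Function.update_comm hg12.symm c true w,
      Function.update_idem, Function.update_idem, Function.update_idem]
  simp only [hterm]
  rw [sum_bool3_first_closed (τ g₂) C₀]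
  congr 1
  -- Step 3: re-pin `g₁` open
  have hg₁F' : g₁ ∉ F.erase g₂ := fun h => hg₁F (Finset.mem_erase.1 h).2
  have hg₂F' : g₂ ∉ F.erase g₂ := fun h => (Finset.mem_erase.1 h).1 rfl
  rw [typedCount_repin_false (F.erase g₂) g₁ hg₁F' (Function.update (Function.update z g₁ true)
    g₂ false) τ, Function.update_of_ne hg12, Function.update_self,
    Function.update_comm hg12.symm false false (Function.update z g₁ true), Function.update_idem,
    ← hz₀, hC₀]
  refine typedCount_congr_K_on _ _ _ fun x y w hagree _ => ?_
  have hx : Function.update (Function.update x g₁ true) g₂ false = Function.update x g₁ true := by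
    refine Function.update_eq_self_iff.2 ?_
    rw [Function.update_of_ne hg12.symm, (hagree g₂ hg₂F').1, hz₀, Function.update_self]
  have hy : Function.update (Function.update y g₁ true) g₂ false = Function.update y g₁ true := by
    refine Function.update_eq_self_iff.2 ?_
    rw [Function.update_of_ne hg12.symm, (hagree g₂ hg₂F').2.1, hz₀, Function.update_self]
  have hw : Function.update (Function.update w g₁ true) g₂ false = Function.update w g₁ true := by
    refine Function.update_eq_self_iff.2 ?_
    rw [Function.update_of_ne hg12.symm, (hagree g₂ hg₂F').2.2, hz₀, Function.update_self]
  rw [hx, hy, hw]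

/-- **The two-edge `o` at `a₃`, class `1`**: if the mark `o` has exactly the two edges
`g₁ = {o, v}` and `g₂ = {o, a₃}`, with `g₁` of class `1`, the typed count of `K₃` is
`C(2, τ g₂)` times the count with `g₁` of type `3` and `g₂` of type `0` — the instance with `o`
contracted into `v` and the `o–a₃` edge removed. -/
theorem typedCount_two_edge_o_one {g₁ g₂ : E} {v : V} (hg₁ : ends g₁ = s(o, v))
    (hg₂ : ends g₂ = s(o, a₃)) (hdeg : ∀ e, o ∈ ends e → e = g₁ ∨ e = g₂)
    (hov : o ≠ v) (ho1 : o ≠ a₁) (ho2 : o ≠ a₂) (ho3 : o ≠ a₃) (hob : o ≠ b) (hg12 : g₁ ≠ g₂)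
    (F : Finset E) (hg₁F : g₁ ∈ F) (hg₂F : g₂ ∈ F) (z : Config E) (τ : E → ℕ) (hτ : τ g₁ = 1) :
    typedCount F z τ (K3 ends o a₁ a₂ a₃ b : Config E → Config E → Config E → R) =
      (Nat.choose 2 (τ g₂) : R) *
        typedCount F z (Function.update (Function.update τ g₁ 3) g₂ 0) (K3 ends o a₁ a₂ a₃ b) := by
  set S := st ends o a₁ a₂ a₃ b with hS
  have hg₂F' : g₂ ∈ F.erase g₁ := Finset.mem_erase.2 ⟨hg12.symm, hg₂F⟩
  have hg₁F' : g₁ ∉ F.erase g₁ := fun h => (Finset.mem_erase.1 h).1 rfl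
  set F'' := (F.erase g₁).erase g₂ with hF''
  set z'' := Function.update (Function.update z g₁ true) g₂ false with hz''
  have hinert : ∀ y : Config E,
      ((S (Function.update y g₁ false)).Lo = false ∧ (S (Function.update y g₁ false)).Ho = false) ∨
      ((S (Function.update y g₁ false)).Lo = (S (Function.update y g₁ false)).L3 ∧
        (S (Function.update y g₁ false)).Ho = (S (Function.update y g₁ false)).H3) :=
    fun y => st_oInert ends o a₁ a₂ a₃ b hg₁ hg₂ hdeg ho1 ho2 _
      (Or.inl (Function.update_self g₁ false y))
  -- the right-hand side: `g₁` pinned open, `g₂` pinned closed, the kernel split by the `o`-copy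
  have hR : typedCount F z (Function.update (Function.update τ g₁ 3) g₂ 0)
      (K3 ends o a₁ a₂ a₃ b : Config E → Config E → Config E → R) =
      typedCount F'' z'' τ (fun x y w => ((KOx (S x) (S y) (S w) : ℤ) : R)) +
      typedCount F'' z'' τ (fun x y w => ((KOy (S x) (S y) (S w) : ℤ) : R)) +
      typedCount F'' z'' τ (fun x y w => ((KOz (S x) (S y) (S w) : ℤ) : R)) := by
    rw [typedCount_type_three F g₁ hg₁F z _
        (by rw [Function.update_of_ne hg12, Function.update_self]),
      typedCount_type_zero (F.erase g₁) g₂ hg₂F' _ _ (Function.update_self g₂ 0 _),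
      typedCount_congr_τ ((F.erase g₁).erase g₂) _ (τ' := τ) (fun e he => by
        rw [Function.update_of_ne (Finset.mem_erase.1 he).1,
          Function.update_of_ne (Finset.mem_erase.1 (Finset.mem_erase.1 he).2).1]),
      ← typedCount_add, ← typedCount_add]
    refine typedCount_congr_K _ _ _ fun x y w => ?_
    rw [K3_eq_KB, ← hS, KB_eq_KOx_add]
    push_cast
    ring
  -- the three placements of `g₁`
  have hx : typedCount (F.erase g₁) (Function.update z g₁ false) τ
      (fun x y w => K3 ends o a₁ a₂ a₃ b (Function.update x g₁ true) (Function.update y g₁ false)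
        (Function.update w g₁ false) : Config E → Config E → Config E → R) =
      (Nat.choose 2 (τ g₂) : R) *
        typedCount F'' z'' τ (fun x y w => ((KOx (S x) (S y) (S w) : ℤ) : R)) := by
    have hk : ∀ x y w : Config E, (K3 ends o a₁ a₂ a₃ b (Function.update x g₁ true)
        (Function.update y g₁ false) (Function.update w g₁ false) : R) =
        ((KOx (S (Function.update x g₁ true)) (S (Function.update y g₁ false))
          (S (Function.update w g₁ false)) : ℤ) : R) := by
      intro x y w
      rw [K3_eq_KB, ← hS, KB_eq_KOx_add, KOy_eq_zero_of_oInert _ _ _ (hinert y),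
        KOz_eq_zero_of_oInert _ _ _ (hinert w)]
      push_cast
      ring
    rw [typedCount_congr_K _ _ _ hk]
    exact typedCount_two_edge_o_slot ends o a₁ a₂ a₃ b KOx
      (fun x y w h1 h2 => KOx_eq_zero_of_oInert x y w (Or.inr ⟨h1, h2⟩)) KOx_killO_y KOx_killO_z
      hg₁ hg₂ hdeg hov ho1 ho2 ho3 hob hg12 (F.erase g₁) hg₁F' hg₂F' z τ
  have hy : typedCount (F.erase g₁) (Function.update z g₁ false) τ
      (fun x y w => K3 ends o a₁ a₂ a₃ b (Function.update x g₁ false) (Function.update y g₁ true)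
        (Function.update w g₁ false) : Config E → Config E → Config E → R) =
      (Nat.choose 2 (τ g₂) : R) *
        typedCount F'' z'' τ (fun x y w => ((KOy (S x) (S y) (S w) : ℤ) : R)) := by
    have hk : ∀ x y w : Config E, (K3 ends o a₁ a₂ a₃ b (Function.update x g₁ false)
        (Function.update y g₁ true) (Function.update w g₁ false) : R) =
        ((KOy (S (Function.update x g₁ false)) (S (Function.update y g₁ true))
          (S (Function.update w g₁ false)) : ℤ) : R) := by
      intro x y w
      rw [K3_eq_KB, ← hS, KB_eq_KOx_add, KOx_eq_zero_of_oInert _ _ _ (hinert x),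
        KOz_eq_zero_of_oInert _ _ _ (hinert w)]
      push_cast
      ring
    rw [typedCount_congr_K _ _ _ hk]
    have h1 : typedCount (F.erase g₁) (Function.update z g₁ false) τ
        (fun x y w => ((KOy (S (Function.update x g₁ false)) (S (Function.update y g₁ true))
          (S (Function.update w g₁ false)) : ℤ) : R)) =
        typedCount (F.erase g₁) (Function.update z g₁ false) τ
        (fun x y w => ((KOy (S (Function.update y g₁ false)) (S (Function.update x g₁ true))
          (S (Function.update w g₁ false)) : ℤ) : R)) :=
      TypedA3.typedCount_swap12 _ _ _ _
    have h2 : typedCount F'' z'' τ (fun x y w => ((KOy (S y) (S x) (S w) : ℤ) : R)) =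
        typedCount F'' z'' τ (fun x y w => ((KOy (S x) (S y) (S w) : ℤ) : R)) :=
      TypedA3.typedCount_swap12 _ _ _ _
    rw [h1, ← h2]
    exact typedCount_two_edge_o_slot ends o a₁ a₂ a₃ b (fun x y w => KOy y x w)
      (fun x y w h1 h2 => KOy_eq_zero_of_oInert y x w (Or.inr ⟨h1, h2⟩))
      (fun x y w => KOy_killO_x y x w) (fun x y w => KOy_killO_z y x w)
      hg₁ hg₂ hdeg hov ho1 ho2 ho3 hob hg12 (F.erase g₁) hg₁F' hg₂F' z τ
  have hz : typedCount (F.erase g₁) (Function.update z g₁ false) τ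
      (fun x y w => K3 ends o a₁ a₂ a₃ b (Function.update x g₁ false) (Function.update y g₁ false)
        (Function.update w g₁ true) : Config E → Config E → Config E → R) =
      (Nat.choose 2 (τ g₂) : R) *
        typedCount F'' z'' τ (fun x y w => ((KOz (S x) (S y) (S w) : ℤ) : R)) := by
    have hk : ∀ x y w : Config E, (K3 ends o a₁ a₂ a₃ b (Function.update x g₁ false)
        (Function.update y g₁ false) (Function.update w g₁ true) : R) =
        ((KOz (S (Function.update x g₁ false)) (S (Function.update y g₁ false))
          (S (Function.update w g₁ true)) : ℤ) : R) := by
      intro x y w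
      rw [K3_eq_KB, ← hS, KB_eq_KOx_add, KOx_eq_zero_of_oInert _ _ _ (hinert x),
        KOy_eq_zero_of_oInert _ _ _ (hinert y)]
      push_cast
      ring
    rw [typedCount_congr_K _ _ _ hk]
    have h1 : typedCount (F.erase g₁) (Function.update z g₁ false) τ
        (fun x y w => ((KOz (S (Function.update x g₁ false)) (S (Function.update y g₁ false))
          (S (Function.update w g₁ true)) : ℤ) : R)) =
        typedCount (F.erase g₁) (Function.update z g₁ false) τ
        (fun x y w => ((KOz (S (Function.update w g₁ false)) (S (Function.update y g₁ false))
          (S (Function.update x g₁ true)) : ℤ) : R)) :=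
      typedCount_swap13' _ _ _ _
    have h2 : typedCount F'' z'' τ (fun x y w => ((KOz (S w) (S y) (S x) : ℤ) : R)) =
        typedCount F'' z'' τ (fun x y w => ((KOz (S x) (S y) (S w) : ℤ) : R)) :=
      typedCount_swap13' _ _ _ _
    rw [h1, ← h2]
    exact typedCount_two_edge_o_slot ends o a₁ a₂ a₃ b (fun x y w => KOz w y x)
      (fun x y w h1 h2 => KOz_eq_zero_of_oInert w y x (Or.inr ⟨h1, h2⟩))
      (fun x y w => KOz_killO_y w y x) (fun x y w => KOz_killO_x w y x)
      hg₁ hg₂ hdeg hov ho1 ho2 ho3 hob hg12 (F.erase g₁) hg₁F' hg₂F' z τ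
  rw [typedCount_split F g₁ hg₁F z τ]
  simp only [Fintype.sum_bool, Bool.toNat_true, Bool.toNat_false, hτ]
  norm_num
  rw [hx, hy, hz, hR]
  ring

/-- **Row 2′TRI at a class-`1` two-edge `o` reduces to the contracted instance**: if the count
with `o` contracted into `v` and the `o–a₃` edge removed is nonnegative, so is the count with
`g₁` of class `1`, whatever the class of `g₂`. -/
theorem typedCount_nonneg_of_two_edge_o_one [LinearOrder R] [IsStrictOrderedRing R]
    {g₁ g₂ : E} {v : V} (hg₁ : ends g₁ = s(o, v))
    (hg₂ : ends g₂ = s(o, a₃)) (hdeg : ∀ e, o ∈ ends e → e = g₁ ∨ e = g₂)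
    (hov : o ≠ v) (ho1 : o ≠ a₁) (ho2 : o ≠ a₂) (ho3 : o ≠ a₃) (hob : o ≠ b) (hg12 : g₁ ≠ g₂)
    (F : Finset E) (hg₁F : g₁ ∈ F) (hg₂F : g₂ ∈ F) (z : Config E) (τ : E → ℕ) (hτ : τ g₁ = 1)
    (h : 0 ≤ typedCount F z (Function.update (Function.update τ g₁ 3) g₂ 0)
      (K3 ends o a₁ a₂ a₃ b : Config E → Config E → Config E → R)) :
    0 ≤ typedCount F z τ (K3 ends o a₁ a₂ a₃ b : Config E → Config E → Config E → R) := by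
  rw [typedCount_two_edge_o_one ends o a₁ a₂ a₃ b hg₁ hg₂ hdeg hov ho1 ho2 ho3 hob hg12 F hg₁F
    hg₂F z τ hτ]
  exact mul_nonneg (Nat.cast_nonneg _) h

end Theorem
end TypedRed

end CovForm

end Summit.Ventures.PercRepro2

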